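import Mathlib.Analysis.Calculus.Deriv.MeanValue
import Summits.FinalStateConjecture.FinalStateConjecture.Theorems.SoloInformedAchronalSlab

/-!
# SoloInformed — honest witnesses comply with F-q: certified slabs inside the leaves of ONE time function

Soloist `solo-FinalStateConjecture-informed` (session 31, 2026-08-19). Companion to
`SoloInformedAchronalSlab.lean` (the repair F-q: ACHRONAL certified slabs) and paper/EXHAUST.md §5.3′.

`SoloInformedAchronalSlab.lean` showed that if every certified slab `certifiedSlab d R τ₁` is
achronal then clause (ii) of `HasExhaustiveCharts` certifies every event of `O` in the
chronological future of the slab. This file records why the INTENDED witnesses satisfy the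
repaired clause `HasAchronalExhaustiveCharts`, in two layers.

**Order-theoretic core** (`isAchronal_of_subset_levelSet`,
`hasAchronalExhaustiveCharts_of_timeFunction`). If `T : M → ℝ` is strictly increasing along the
chronological relation on a set `A` (`p, q ∈ A`, `q ∈ I⁺(p)` ⟹ `T p < T q`) and a set `S ⊆ A` lies
in one level set `{T = c}`, then `S` is achronal. Hence a witness of the typed clause whose
certified slab at every label `τ₁ > τ₀` lies in the level set `{T = τ₁}` of one such `T` is a
witness of the repaired clause. In the intended witnesses `A` is the Kerr–Schild patch of the
settled region (a future set, so `I⁺` computed in `M` and in `A` agree for points of `A`) and `T`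
is a temporal function whose leaves are `{t* = τ}` on the near zone `{r ≤ R(τ)}` and `{t = τ}` on
the far zone `{r ≥ ρ(τ)}`.

**The leaves, on the exact Schwarzschild exterior** (namespace `TemporalLeaf`; ingoing
Eddington–Finkelstein / Kerr–Schild coordinates `(t*, r, ω)`, `t* = v − r`,
`g = −(1−2M/r) dt*² + (4M/r) dt* dr + (1+2M/r) dr² + r² dω²`). For a graph `t* = h(r)` the induced
`dr²`-coefficient is, with `m := 2M/r`,
`Q(m, h′) = −(1−m) h′² + 2m h′ + (1+m) = (1 + h′)·((1+m) − (1−m) h′)` (`radialCoeff_eq_mul`), so on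
the exterior `0 ≤ m < 1` the graph is spacelike iff `−1 < h′ < (1+m)/(1−m)` (between the ingoing
null slope `v = const` and the outgoing null slope `u = const`; `radialCoeff_pos_iff`,
`radialCoeff_neg_one`, `radialCoeff_outgoing`). The Kerr–Schild leaf `h′ = 0` has `Q = 1 + m > 0`
for every `r > 0`, horizon and interior included (`radialCoeff_zero`); the static leaf `t = τ`,
i.e. `t* = τ + 2M log(r/2M − 1)`, has `h′ = m/(1−m)` and `Q = 1/(1−m)` (`radialCoeff_static`); the
interpolated leaf `t* = τ + (1 − χ_τ(r))·2M log(r/2M − 1)`, `χ_τ` decreasing from `1` at `r = R(τ)`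
to `0` at `r = ρ(τ)`, has slope `h′ = a·L + (1−χ)·m/(1−m)` with `a = |χ_τ′(r)| ≥ 0`,
`L = 2M log(r/2M − 1) ≥ 0` (`R ≥ 4M`), and is spacelike as soon as `a·L < 1`
(`radialCoeff_interpolated_pos`) — e.g. `ρ − R > 4M log(ρ/2M)` for a cut-off with `|χ′| ≤ 2/(ρ−R)`.
The leaves are NESTED (the `t*`-value `τ ↦ τ + (1 − χ_τ(r))·L(r)` at fixed `r` is strictly
increasing) iff the label-Lipschitz bound `(χ_{τ′}(r) − χ_τ(r))·L(r) < τ′ − τ` holds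
(`leafValue_strictMono`), which follows from `∂_τ χ_τ(r) · L(r) ≤ 1/2` by the mean value theorem
(`leafValue_strictMono_of_deriv_le`) — e.g. `4M log(ρ/2M)·(2R′ + ρ′) < ρ − R`, automatic for slowly
growing `R ≪ ρ = o(τ)`. A smooth function with nested spacelike level sets filling the patch is a
temporal function (implicit function theorem + "the normal of a spacelike hypersurface is
timelike"); that last differential-geometric step, and the identification of the honest far /
near certified slab pieces `{t = τ₁, r > ρ(τ₁)}` / `{t* = τ₁, r ≤ R(τ₁)}` with subsets of the leaf
`{T = τ₁}`, are carried out in paper/EXHAUST.md §5.3′, not here.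

References: [DafermosLuk2017] M. Dafermos, J. Luk, arXiv:1710.01722, Conjecture 1 (b)–(c);
O'Neill 1983, Ch. 14, p. 413 (achronal sets), Ch. 13 (Schwarzschild, ingoing coordinates);
Hawking–Ellis 1973, §5.5 (Eddington–Finkelstein form), §6.3; Bernal–Sánchez, Lett. Math. Phys. 77 (2006)
183–197, §1 (temporal functions). [BernalSanchez2006]
-/

open Literature.Geometry.Lorentzian
open scoped Manifold ContDiff Topology
open Filter Set

set_option linter.dupNamespace false

namespace Summit.FinalStateConjecture.FinalStateConjecture.Theorems

section TimeFunction

variable {𝓢 : Spacetime.{0} 4} {O : Set 𝓢.carrier} {k : ℕ}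

/-- **A subset of one level set of a chronology-monotone function is achronal.** If `T` is
strictly increasing along the chronological relation between points of `A` and `S ⊆ A` lies in
the level set `{T = c}`, then no two points of `S` are chronologically related.
O'Neill 1983, Ch. 14, p. 413. [cite: ONeill1983, Ch. 14  p. 413] -/
theorem isAchronal_of_subset_levelSet {A S : Set 𝓢.carrier} (T : 𝓢.carrier → ℝ) (c : ℝ)
    (hT : ∀ p ∈ A, ∀ q ∈ A,
      q ∈ 𝓢.metric.chronologicalFuture 𝓢.timeOrientation {p} → T p < T q)
    (hSA : S ⊆ A) (hSc : ∀ p ∈ S, T p = c) :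
    𝓢.metric.IsAchronal 𝓢.timeOrientation S := by
  intro p hp q hq hqp
  have h := hT p (hSA hp) q (hSA hq) hqp
  rw [hSc p hp, hSc q hq] at h
  exact lt_irrefl _ h

/-- Two pieces of the same level set (e.g. the far flat slab piece and the truncated Kerr–Schild
slab piece of a certified slab) form an achronal set. [cite: ONeill1983, Ch. 14  p. 413] -/
theorem isAchronal_union_of_subset_levelSet {A S₁ S₂ : Set 𝓢.carrier} (T : 𝓢.carrier → ℝ)
    (c : ℝ)
    (hT : ∀ p ∈ A, ∀ q ∈ A,
      q ∈ 𝓢.metric.chronologicalFuture 𝓢.timeOrientation {p} → T p < T q)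
    (h₁ : S₁ ⊆ A) (h₂ : S₂ ⊆ A) (h₁c : ∀ p ∈ S₁, T p = c) (h₂c : ∀ p ∈ S₂, T p = c) :
    𝓢.metric.IsAchronal 𝓢.timeOrientation (S₁ ∪ S₂) :=
  isAchronal_of_subset_levelSet T c hT (union_subset h₁ h₂)
    (fun p hp ↦ hp.elim (h₁c p) (h₂c p))

/-- **Certified slab inside a leaf of a time function ⇒ achronal.** If the certified slab at
chart time `τ₁` lies in `A` and in the level set `{T = τ₁}` of a function `T` strictly increasing
along the chronological relation on `A`, it is achronal — the hypothesis of the repair F-q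
(`SoloInformedAchronalSlab.lean`). [cite: DafermosLuk2017, Conjecture 1 (b)–(c)] -/
theorem isAchronal_certifiedSlab_of_timeFunction (d : FinalStateDecomposition 𝓢 O k)
    (R : Fin d.N → ℝ → ℝ) (τ₁ : ℝ) {A : Set 𝓢.carrier} (T : 𝓢.carrier → ℝ)
    (hT : ∀ p ∈ A, ∀ q ∈ A,
      q ∈ 𝓢.metric.chronologicalFuture 𝓢.timeOrientation {p} → T p < T q)
    (hSA : Summit.FinalStateConjecture.certifiedSlab d R τ₁ ⊆ A)
    (hSc : ∀ p ∈ Summit.FinalStateConjecture.certifiedSlab d R τ₁, T p = τ₁) :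
    𝓢.metric.IsAchronal 𝓢.timeOrientation (Summit.FinalStateConjecture.certifiedSlab d R τ₁) :=
  isAchronal_of_subset_levelSet T τ₁ hT hSA hSc

/-- **Honest witnesses comply with F-q.** A witness of the typed clause `HasExhaustiveCharts d`
(radii `Rᵢ → ∞` above `r₊ + 1`, truncated deviations `→ 0`, covering clause (ii)) whose certified
slab at every label `τ₁ > τ₀` lies in the leaf `{T = τ₁}` of ONE function `T` strictly increasing
along the chronological relation on a set `A ⊇` the slabs, is a witness of the repaired clause
`HasAchronalExhaustiveCharts d`. In the intended witnesses `T` is a temporal function of the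
settled region inducing Kerr–Schild time on the near zones and the flat chart's time on the far
zone (paper/EXHAUST.md §5.3′; the leaves are computed in namespace `TemporalLeaf` below).
[cite: DafermosLuk2017, Conjecture 1 (b)–(c)] -/
theorem hasAchronalExhaustiveCharts_of_timeFunction (d : FinalStateDecomposition 𝓢 O k)
    (R : Fin d.N → ℝ → ℝ)
    (hR : ∀ i, Tendsto (R i) atTop atTop ∧
      ∀ τ, max (Kerr.rPlus (d.mass i) (d.spin i)) 0 + 1 ≤ R i τ)
    (hdev : ∀ i, Tendsto (fun τ ↦ 𝓢.truncDeviationCk (d.background i) (d.chart i) k (R i τ) τ)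
      atTop (𝓝 0))
    (hii : ∀ τ₁ : ℝ, d.τ₀ < τ₁ →
      O \ Summit.FinalStateConjecture.certifiedLate d R τ₁ ⊆
        𝓢.metric.causalPast 𝓢.timeOrientation
          (Summit.FinalStateConjecture.certifiedSlab d R τ₁))
    {A : Set 𝓢.carrier} (T : 𝓢.carrier → ℝ)
    (hT : ∀ p ∈ A, ∀ q ∈ A,
      q ∈ 𝓢.metric.chronologicalFuture 𝓢.timeOrientation {p} → T p < T q)
    (hslab : ∀ τ₁ : ℝ, d.τ₀ < τ₁ → Summit.FinalStateConjecture.certifiedSlab d R τ₁ ⊆ A)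
    (hlevel : ∀ τ₁ : ℝ, d.τ₀ < τ₁ →
      ∀ p ∈ Summit.FinalStateConjecture.certifiedSlab d R τ₁, T p = τ₁) :
    HasAchronalExhaustiveCharts d :=
  ⟨R, hR, hdev,
    fun τ₁ hτ ↦ isAchronal_of_subset_levelSet T τ₁ hT (hslab τ₁ hτ) (hlevel τ₁ hτ), hii⟩

/-- Corollary: for such a witness every event of `O` in the chronological future of a certified
slab is certified-late at that label (the payoff of `SoloInformedAchronalSlab.lean`).
[cite: DafermosLuk2017, Conjecture 1 (b)–(c)] -/
theorem inter_chronologicalFuture_subset_certifiedLate_of_timeFunction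
    (d : FinalStateDecomposition 𝓢 O k) (R : Fin d.N → ℝ → ℝ) {τ₁ : ℝ}
    (hii : O \ Summit.FinalStateConjecture.certifiedLate d R τ₁ ⊆
      𝓢.metric.causalPast 𝓢.timeOrientation (Summit.FinalStateConjecture.certifiedSlab d R τ₁))
    {A : Set 𝓢.carrier} (T : 𝓢.carrier → ℝ)
    (hT : ∀ p ∈ A, ∀ q ∈ A,
      q ∈ 𝓢.metric.chronologicalFuture 𝓢.timeOrientation {p} → T p < T q)
    (hSA : Summit.FinalStateConjecture.certifiedSlab d R τ₁ ⊆ A)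
    (hSc : ∀ p ∈ Summit.FinalStateConjecture.certifiedSlab d R τ₁, T p = τ₁) :
    O ∩ 𝓢.metric.chronologicalFuture 𝓢.timeOrientation
        (Summit.FinalStateConjecture.certifiedSlab d R τ₁) ⊆
      Summit.FinalStateConjecture.certifiedLate d R τ₁ :=
  inter_chronologicalFuture_subset_certifiedLate d R hii
    (isAchronal_certifiedSlab_of_timeFunction d R τ₁ T hT hSA hSc)

end TimeFunction

/-! ### The leaves on the exact Schwarzschild exterior (ingoing Eddington–Finkelstein algebra) -/

namespace TemporalLeaf

/-- Induced `dr²`-coefficient of the graph `t* = h(r)` in ingoing Eddington–Finkelstein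
Schwarzschild coordinates, as a function of `m = 2M/r` and the slope `h′`:
`Q(m, h′) = −(1−m) h′² + 2m h′ + (1+m)`. The graph is spacelike iff `Q > 0`.
Hawking–Ellis 1973, §5.5. [cite: HawkingEllis1973, §5.5] -/
def radialCoeff (m h' : ℝ) : ℝ := -(1 - m) * h' ^ 2 + 2 * m * h' + (1 + m)

/-- The same coefficient written with `M` and `r`:
`Q = −(1−2M/r) h′² + (4M/r) h′ + (1+2M/r)`. [cite: HawkingEllis1973, §5.5] -/
theorem radialCoeff_schwarzschild (M r h' : ℝ) :
    radialCoeff (2 * M / r) h' =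
      -(1 - 2 * M / r) * h' ^ 2 + (4 * M / r) * h' + (1 + 2 * M / r) := by
  unfold radialCoeff; ring

/-- **Factorisation through the two null slopes**: `Q(m, h′) = (1 + h′)·((1+m) − (1−m) h′)`.
[cite: HawkingEllis1973, §5.5] -/
theorem radialCoeff_eq_mul (m h' : ℝ) :
    radialCoeff m h' = (1 + h') * ((1 + m) - (1 - m) * h') := by
  unfold radialCoeff; ring

/-- The ingoing null slope `h′ = −1` (`v = t* + r = const`) is a root. [cite: HawkingEllis1973, §5.5] -/
theorem radialCoeff_neg_one (m : ℝ) : radialCoeff m (-1) = 0 := by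
  unfold radialCoeff; ring

/-- The outgoing null slope `h′ = (1+m)/(1−m)` (`u = const`, exterior `m ≠ 1`) is the other root.
[cite: HawkingEllis1973, §5.5] -/
theorem radialCoeff_outgoing (m : ℝ) (hm : m ≠ 1) : radialCoeff m ((1 + m) / (1 - m)) = 0 := by
  have h1 : (1 - m) ≠ 0 := sub_ne_zero.mpr (Ne.symm hm)
  rw [radialCoeff_eq_mul]
  have : (1 + m) - (1 - m) * ((1 + m) / (1 - m)) = 0 := by
    field_simp
    ring
  rw [this, mul_zero]

/-- **Spacelike criterion on the exterior** (`m = 2M/r < 1`): the graph `t* = h(r)` is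
spacelike iff its slope lies strictly between the two null slopes,
`−1 < h′` and `(1−m) h′ < 1+m`. [cite: HawkingEllis1973, §5.5] -/
theorem radialCoeff_pos_iff (m h' : ℝ) (hm1 : m < 1) :
    0 < radialCoeff m h' ↔ -1 < h' ∧ (1 - m) * h' < 1 + m := by
  rw [radialCoeff_eq_mul]
  constructor
  · intro h
    rcases pos_and_pos_or_neg_and_neg_of_mul_pos h with ⟨h1, h2⟩ | ⟨h1, h2⟩
    · exact ⟨by linarith, by linarith⟩
    · exfalso
      have h3 : (1 - m) * (1 + h') < 0 := mul_neg_of_pos_of_neg (by linarith) h1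
      nlinarith [h3, h2]
  · rintro ⟨h1, h2⟩
    exact mul_pos (by linarith) (by linarith)

/-- The Kerr–Schild leaf `t* = τ` (`h′ = 0`) has `Q = 1 + m`, positive for every `r > 0`
(`m = 2M/r ≥ 0`): it is spacelike across the horizon and inside it. [cite: HawkingEllis1973, §5.5] -/
theorem radialCoeff_zero (m : ℝ) : radialCoeff m 0 = 1 + m := by
  unfold radialCoeff; ring

/-- Positivity of the Kerr–Schild leaf coefficient `1 + m` for `m ≥ 0` (every `r > 0`).
[cite: HawkingEllis1973, §5.5] -/
theorem radialCoeff_zero_pos (m : ℝ) (hm : 0 ≤ m) : 0 < radialCoeff m 0 := by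
  rw [radialCoeff_zero]; linarith

/-- The static leaf `t = τ`, i.e. `t* = τ + 2M log(r/2M − 1)`, has slope `h′ = m/(1−m)` and
`Q = 1/(1−m) > 0` on the exterior. [cite: HawkingEllis1973, §5.5] -/
theorem radialCoeff_static (m : ℝ) (hm : m ≠ 1) : radialCoeff m (m / (1 - m)) = 1 / (1 - m) := by
  have h1 : (1 - m) ≠ 0 := sub_ne_zero.mpr (Ne.symm hm)
  unfold radialCoeff
  field_simp
  ring

/-- The static leaf `t = τ` is spacelike on the exterior `m < 1`. [cite: HawkingEllis1973, §5.5] -/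
theorem radialCoeff_static_pos (m : ℝ) (hm1 : m < 1) : 0 < radialCoeff m (m / (1 - m)) := by
  rw [radialCoeff_static m (ne_of_lt hm1)]
  exact one_div_pos.mpr (by linarith)

/-- The slope of the static leaf: `d/dr [2M log(r/2M − 1)] = 2M/(r − 2M) = m/(1−m)` for
`r > 2M > 0`. [cite: HawkingEllis1973, §5.5] -/
theorem hasDerivAt_tortoiseLog (M r : ℝ) (hM : 0 < M) (hr : 2 * M < r) :
    HasDerivAt (fun r ↦ 2 * M * Real.log (r / (2 * M) - 1)) (2 * M / (r - 2 * M)) r := by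
  have h2M : (0 : ℝ) < 2 * M := by linarith
  have harg : r / (2 * M) - 1 ≠ 0 := by
    have : 1 < r / (2 * M) := by rw [lt_div_iff₀ h2M]; linarith
    linarith
  have hinner : HasDerivAt (fun r ↦ r / (2 * M) - 1) (1 / (2 * M)) r := by
    have := (hasDerivAt_id r).div_const (2 * M)
    simpa using this.sub_const 1
  have hlog := (Real.hasDerivAt_log harg).comp r hinner
  have hder := hlog.const_mul (2 * M)
  have hM0 : M ≠ 0 := hM.ne'
  have h2M0 : (2 : ℝ) * M ≠ 0 := by positivity
  have hr2 : r - 2 * M ≠ 0 := ne_of_gt (by linarith)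
  have hval : 2 * M * ((r / (2 * M) - 1)⁻¹ * (1 / (2 * M))) = 2 * M / (r - 2 * M) := by
    rw [show r / (2 * M) - 1 = (r - 2 * M) / (2 * M) by field_simp, inv_div]
    field_simp
  exact hder.congr_deriv hval

/-- `2M/(r − 2M) = m/(1 − m)` with `m = 2M/r` (`r > 2M > 0`): the static slope in the form used by
`radialCoeff_static`. [cite: HawkingEllis1973, §5.5] -/
theorem static_slope_eq (M r : ℝ) (hM : 0 < M) (hr : 2 * M < r) :
    2 * M / (r - 2 * M) = (2 * M / r) / (1 - 2 * M / r) := by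
  have hr0 : r ≠ 0 := by intro h; subst h; linarith
  have hr2 : r - 2 * M ≠ 0 := by intro h; linarith
  field_simp

/-- **The interpolated leaf is spacelike.** Slope `h′ = a·L + (1−χ)·m/(1−m)` with `a = |χ′| ≥ 0`,
`L = 2M log(r/2M − 1) ≥ 0`, `0 ≤ χ ≤ 1`, on the exterior `0 ≤ m < 1`: if `a·L < 1` then `Q > 0`.
(With `|χ′| ≤ 2/(ρ − R)` this is `ρ − R > 4M log(ρ/2M − 1)`.) [cite: HawkingEllis1973, §5.5] -/
theorem radialCoeff_interpolated_pos (m a L χ : ℝ) (hm0 : 0 ≤ m) (hm1 : m < 1) (ha : 0 ≤ a)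
    (hL : 0 ≤ L) (hχ0 : 0 ≤ χ) (hχ1 : χ ≤ 1) (haL : a * L < 1) :
    0 < radialCoeff m (a * L + (1 - χ) * (m / (1 - m))) := by
  have h1m : 0 < 1 - m := by linarith
  rw [radialCoeff_pos_iff m _ hm1]
  constructor
  · have : 0 ≤ (1 - χ) * (m / (1 - m)) := mul_nonneg (by linarith) (div_nonneg hm0 h1m.le)
    nlinarith [mul_nonneg ha hL]
  · have key : (1 - m) * (a * L + (1 - χ) * (m / (1 - m))) = (1 - m) * (a * L) + (1 - χ) * m := by
      field_simp
    rw [key]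
    nlinarith [mul_pos h1m (by linarith : (0 : ℝ) < 1 - a * L), mul_nonneg hχ0 hm0]

/-- **Nested leaves.** At fixed radius the `t*`-value of the leaf with label `τ` is
`F(τ) = τ + (1 − χ_τ)·L`; if the cut-off is label-Lipschitz in the sense
`(χ_{τ′} − χ_τ)·L < τ′ − τ` for `τ < τ′`, then `F` is strictly increasing (the leaves do not
cross). [cite: BernalSanchez2006, §1] -/
theorem leafValue_strictMono (L : ℝ) (χ : ℝ → ℝ)
    (hχ : ∀ τ τ', τ < τ' → (χ τ' - χ τ) * L < τ' - τ) :
    StrictMono (fun τ ↦ τ + (1 - χ τ) * L) := by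
  intro τ τ' h
  have := hχ τ τ' h
  dsimp only
  nlinarith [this]

/-- The label-Lipschitz bound from a derivative bound `∂_τ χ_τ · L ≤ 1/2` (mean value theorem);
for the cut-off `χ_τ(r) = λ((r − R(τ))/(ρ(τ) − R(τ)))` one has `|∂_τ χ| ≤ 2(2R′ + ρ′)/(ρ − R)`, so the
bound reads `4M log(ρ/2M − 1)·(2R′ + ρ′) ≤ ρ − R`. [cite: BernalSanchez2006, §1] -/
theorem leafValue_strictMono_of_deriv_le (L : ℝ) (hL : 0 ≤ L) (χ : ℝ → ℝ)
    (hχd : Differentiable ℝ χ) (hχ' : ∀ τ, deriv χ τ * L ≤ 1 / 2) :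
    StrictMono (fun τ ↦ τ + (1 - χ τ) * L) := by
  apply leafValue_strictMono
  intro τ τ' h
  rcases eq_or_lt_of_le hL with hL0 | hLpos
  · rw [← hL0, mul_zero]; linarith
  have hb : ∀ x, deriv χ x ≤ 1 / (2 * L) := fun x ↦ by
    rw [le_div_iff₀ (by positivity)]
    linarith [hχ' x]
  have hmv := image_sub_le_mul_sub_of_deriv_le hχd hb h.le
  calc (χ τ' - χ τ) * L ≤ 1 / (2 * L) * (τ' - τ) * L :=
        mul_le_mul_of_nonneg_right hmv hL
    _ = (τ' - τ) / 2 := by field_simp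
    _ < τ' - τ := by linarith

/-- The leaf value lies between the Kerr–Schild value `τ` and the static value `τ + L`
(`0 ≤ χ ≤ 1`, `L ≥ 0`), so at fixed radius `F` is a strictly increasing surjection `ℝ → ℝ` once it
is continuous — the leaves fill the patch. [cite: BernalSanchez2006, §1] -/
theorem leafValue_mem_Icc (τ L χ : ℝ) (hL : 0 ≤ L) (hχ0 : 0 ≤ χ) (hχ1 : χ ≤ 1) :
    τ + (1 - χ) * L ∈ Icc τ (τ + L) := by
  constructor <;> nlinarith [mul_nonneg hχ0 hL, mul_nonneg (by linarith : (0:ℝ) ≤ 1 - χ) hL]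

/-- **Future-directedness of the leaf function.** In ingoing EF coordinates the future timelike
field `V = −g♯(dt*)` has components `(V^{t*}, V^r) = (1 + m, −m)` (`m = 2M/r`), and for a function
`T` with `dT = (dt* − F_r dr)/F_τ`, `F_τ > 0`, `F_r ≥ 0`, one gets
`F_τ · dT(V) = (1 + m) + m F_r > 0`: `T` increases along `V`. [cite: HawkingEllis1973, §5.5] -/
theorem leaf_dT_timeVector_pos (m Fr : ℝ) (hm : 0 ≤ m) (hFr : 0 ≤ Fr) :
    0 < (1 + m) * 1 + m * Fr := by
  nlinarith [mul_nonneg hm hFr]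

/-- The inverse metric block in `(t*, r)`: `g^{t*t*} = −(1+m)`, `g^{t*r} = m`, `g^{rr} = 1 − m`
inverts `g_{t*t*} = −(1−m)`, `g_{t*r} = m`, `g_{rr} = 1+m` (determinant `−1`).
[cite: HawkingEllis1973, §5.5] -/
theorem inverse_block (m : ℝ) :
    (-(1 - m)) * (-(1 + m)) + m * m = 1 ∧ (-(1 - m)) * m + m * (1 - m) = 0 ∧
      m * (-(1 + m)) + (1 + m) * m = 0 ∧ m * m + (1 + m) * (1 - m) = 1 := by
  refine ⟨by ring, by ring, by ring, by ring⟩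

end TemporalLeaf

end Summit.FinalStateConjecture.FinalStateConjecture.Theorems
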